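import Literature.Combinatorics.Optimization.ShellLawRelabeling
import Literature.Combinatorics.Optimization.ShellLawSmoothing
import Literature.Combinatorics.Optimization.ShellLawHalfPinning
import HarnessLib

/-!
# Cell pnp-psdrank, route `ChebyshevTracialDesign`: EXCHANGEABILITY of the block edges under the shell measure, I —
# edge swaps inside a ground set and the in-set fibres (brick 157a; crux `TracialDecayExp20`, stmt-PneNP-19878)

Brick 157a (prover g31; MEMO-33 §5 rev 2 (E)/(S), MEMO-34 §1). Fix a perfect matching (partner involution `π`, fixed-point-free), a
`π`-stable ground set `S` and a block `H` WITHOUT an edge of `S` inside (`v ∈ S ∩ H ⇒ πv ∉ H`: after the `HH`-class split of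
the small-block line every class lives on such a reduced ground set, bricks 151/152). The `b = |S ∩ H|` edges of `S` meeting `H` are
EXCHANGEABLE under the uniform measure of every shell `Shell_S(t,c)`: the swap `(a a′)(πa πa′)` of two of them commutes with `π`,
preserves `S` and `H` (brick 145a's admissible swaps, here for an abstract partner map and inside a ground set), hence permutes the
shell and transports the IN-SET `U ∩ H`:

* §1 `map_mem_shellIn_iff`, `map_inter_eq`, **`card_filter_inter_eq_map`** — an admissible permutation `g` maps `Shell_S(t,c)` to itself
  and `#{U : U ∩ H = g(I)} = #{U : U ∩ H = I}`;
* §2 **`exists_edge_swap`** — the swap of two block edges is admissible; bookkeeping `no_internal_edge_of_reps_vAA` /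
  `card_reps_vB_eq_card_inter` linking the hypotheses of bricks 151a–156 (`|reps(AA)| = 0`, `|reps(B)| = b`) to the ones used here;
* §3 **`card_filter_inter_eq_eq_of_card_eq`** — the fibre count `#{U ∈ Shell_S(t,c) : U ∩ H = I}` depends on `I ⊆ S ∩ H` only through
  `|I|` (induction on `|I ∖ I′|`, one swap at a time).
Consumed by brick 157b (conditionally on `|U ∩ H|` the traces on two disjoint sub-blocks are hypergeometric; a bivariate mask averages
to a univariate mixture). WHAT THIS FILE DOES NOT DO: anything quantitative; anything on `TracialDecayExp20` itself, psd rank of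
P_PM(K_n), or P vs NP. [cite: Rothvoss2017, §2 (PDF pp. 5–6)] [cite: GodsilMeagher2015, §15.2]
Stature: support/instrument (kernel lane, no defs, axioms standard). Supports stmt-PneNP-19878.
-/

set_option linter.dupNamespace false -- `Summit.PneNP.PneNP.…`: summit = sub-problem (D-0017)

noncomputable section

namespace Summit.PneNP.PneNP.Theorems.ChebyshevTracialDesignBlockEdgeSwaps

open Finset Literature.Combinatorics.Optimization Literature.Combinatorics.Optimization.ShellStep

variable {n : ℕ} {π : Fin n → Fin n}

/-! ### §1 Admissible permutations act on the shells of a ground set and transport the in-set -/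

/-- An `H`-preserving permutation fixes `H` as a set: `H.map g = H`. [folklore] -/
theorem map_eq_self_of_preserves (g : Equiv.Perm (Fin n)) {H : Finset (Fin n)} (hgH : ∀ i, g i ∈ H ↔ i ∈ H) :
    H.map g.toEmbedding = H := by
  ext b
  rw [mem_map_equiv]
  have h := hgH (g.symm b)
  rw [Equiv.apply_symm_apply] at h
  exact h.symm

/-- A permutation commuting with `π` and preserving `S` maps `Shell_S(t,c)` to itself: `g(U) ∈ Shell_S(t,c) ↔ U ∈ Shell_S(t,c)`.
[cite: Rothvoss2017, §2 (PDF p. 6)] -/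
theorem map_mem_shellIn_iff (g : Equiv.Perm (Fin n)) (hgπ : ∀ i, g (π i) = π (g i)) {S : Finset (Fin n)}
    (hgS : ∀ i, g i ∈ S ↔ i ∈ S) (t c : ℕ) (U : Finset (Fin n)) :
    U.map g.toEmbedding ∈ shellIn π S t c ↔ U ∈ shellIn π S t c := by
  rw [mem_shellIn, mem_shellIn, card_map, half_map_eq (π' := π) (f := g.toEmbedding) (fun i => hgπ i), card_map]
  have hsub : U.map g.toEmbedding ⊆ S ↔ U ⊆ S := by
    conv_lhs => rw [← map_eq_self_of_preserves g hgS]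
    exact map_subset_map
  rw [hsub]

/-- The in-set is transported: `g(U) ∩ H = g(U ∩ H)` for `H`-preserving `g`. [cite: Rothvoss2017, §2 (PDF p. 6)] -/
theorem map_inter_eq (g : Equiv.Perm (Fin n)) {H : Finset (Fin n)} (hgH : ∀ i, g i ∈ H ↔ i ∈ H) (U : Finset (Fin n)) :
    U.map g.toEmbedding ∩ H = (U ∩ H).map g.toEmbedding := by
  classical
  conv_lhs => rw [← map_eq_self_of_preserves g hgH]
  rw [map_inter]

/-- The inverse of an admissible permutation is admissible. [folklore] -/
theorem symm_admissible (g : Equiv.Perm (Fin n)) (hgπ : ∀ i, g (π i) = π (g i)) {S : Finset (Fin n)}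
    (hgS : ∀ i, g i ∈ S ↔ i ∈ S) :
    (∀ i, g.symm (π i) = π (g.symm i)) ∧ (∀ i, g.symm i ∈ S ↔ i ∈ S) := by
  refine ⟨fun i => ?_, fun i => ?_⟩
  · apply g.injective; rw [Equiv.apply_symm_apply, hgπ, Equiv.apply_symm_apply]
  · have h := hgS (g.symm i)
    rw [Equiv.apply_symm_apply] at h
    exact h.symm

/-- **Transport of the in-set fibres**: for an admissible `g` (commutes with `π`, preserves `S` and `H`),
`#{U ∈ Shell_S(t,c) : U ∩ H = g(I)} = #{U ∈ Shell_S(t,c) : U ∩ H = I}`. [cite: Rothvoss2017, §2 (PDF p. 6)] -/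
theorem card_filter_inter_eq_map (g : Equiv.Perm (Fin n)) (hgπ : ∀ i, g (π i) = π (g i)) {S H : Finset (Fin n)}
    (hgS : ∀ i, g i ∈ S ↔ i ∈ S) (hgH : ∀ i, g i ∈ H ↔ i ∈ H) (t c : ℕ) (I : Finset (Fin n)) :
    ((shellIn π S t c).filter fun U => U ∩ H = I.map g.toEmbedding).card =
      ((shellIn π S t c).filter fun U => U ∩ H = I).card := by
  symm
  obtain ⟨hg'π, hg'S⟩ := symm_admissible g hgπ hgS
  refine card_nbij' (fun U => U.map g.toEmbedding) (fun U => U.map g.symm.toEmbedding) ?_ ?_ ?_ ?_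
  · intro U hU
    rw [mem_coe, mem_filter] at hU ⊢
    refine ⟨(map_mem_shellIn_iff g hgπ hgS t c U).2 hU.1, ?_⟩
    rw [map_inter_eq g hgH, hU.2]
  · intro U hU
    rw [mem_coe, mem_filter] at hU ⊢
    refine ⟨(map_mem_shellIn_iff g.symm hg'π hg'S t c U).2 hU.1, ?_⟩
    have hg'H : ∀ i, g.symm i ∈ H ↔ i ∈ H := (symm_admissible g hgπ hgH).2
    rw [map_inter_eq g.symm hg'H, hU.2, map_map]
    convert map_refl (s := I) using 2; ext x; simp
  · intro U _
    show (U.map g.toEmbedding).map g.symm.toEmbedding = U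
    rw [map_map]; convert map_refl (s := U) using 2; ext x; simp
  · intro U _
    show (U.map g.symm.toEmbedding).map g.toEmbedding = U
    rw [map_map]; convert map_refl (s := U) using 2; ext x; simp

/-! ### §2 The edge swap; bookkeeping of the «no internal edge» hypothesis -/

section Swap

variable (hπ : ∀ v, π (π v) = v) (hπ' : ∀ v, π v ≠ v)
include hπ hπ'

/-- **The swap of two block edges is admissible.** `S` stable, `H` without an edge of `S` inside, `a ≠ a′` in `S ∩ H`: the
permutation `(a a′)(πa πa′)` commutes with `π`, preserves `S` and `H`, exchanges `a` and `a′`, and fixes every vertex outside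
`{a, a′, πa, πa′}`. [cite: Rothvoss2017, §2 (PDF p. 5)] [cite: GodsilMeagher2015, §15.2] -/
theorem exists_edge_swap {S H : Finset (Fin n)} (hS : ∀ v ∈ S, π v ∈ S) (hno : ∀ v ∈ S, ¬ (v ∈ H ∧ π v ∈ H))
    {a a' : Fin n} (ha : a ∈ S ∩ H) (ha' : a' ∈ S ∩ H) (hne : a' ≠ a) :
    ∃ g : Equiv.Perm (Fin n), (∀ i, g (π i) = π (g i)) ∧ (∀ i, g i ∈ S ↔ i ∈ S) ∧ (∀ i, g i ∈ H ↔ i ∈ H) ∧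
      g a = a' ∧ g a' = a ∧ ∀ x, x ≠ a → x ≠ a' → x ≠ π a → x ≠ π a' → g x = x := by
  obtain ⟨haS, haH⟩ := mem_inter.1 ha
  obtain ⟨ha'S, ha'H⟩ := mem_inter.1 ha'
  have hπaH : π a ∉ H := fun h => hno a haS ⟨haH, h⟩
  have hπa'H : π a' ∉ H := fun h => hno a' ha'S ⟨ha'H, h⟩
  -- the four vertices `a, a′, πa, πa′` are pairwise distinct
  have d1 : π a ≠ a := hπ' a
  have d2 : π a' ≠ a' := hπ' a'
  have d3 : a' ≠ π a := fun h => hπaH (h ▸ ha'H)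
  have d5 : π a' ≠ a := fun h => hπa'H (h ▸ haH)
  have d6 : π a' ≠ π a := fun h => hne (by rw [← hπ a', h, hπ])
  refine ⟨Equiv.swap a a' * Equiv.swap (π a) (π a'), ?_⟩
  have ga : (Equiv.swap a a' * Equiv.swap (π a) (π a')) a = a' := by
    rw [Equiv.Perm.mul_apply, Equiv.swap_apply_of_ne_of_ne d1.symm d5.symm, Equiv.swap_apply_left]
  have gb : (Equiv.swap a a' * Equiv.swap (π a) (π a')) a' = a := by
    rw [Equiv.Perm.mul_apply, Equiv.swap_apply_of_ne_of_ne d3 d2.symm, Equiv.swap_apply_right]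
  have gπa : (Equiv.swap a a' * Equiv.swap (π a) (π a')) (π a) = π a' := by
    rw [Equiv.Perm.mul_apply, Equiv.swap_apply_left, Equiv.swap_apply_of_ne_of_ne d5 d2]
  have gπb : (Equiv.swap a a' * Equiv.swap (π a) (π a')) (π a') = π a := by
    rw [Equiv.Perm.mul_apply, Equiv.swap_apply_right, Equiv.swap_apply_of_ne_of_ne d1 d3.symm]
  have gx : ∀ x, x ≠ a → x ≠ a' → x ≠ π a → x ≠ π a' →
      (Equiv.swap a a' * Equiv.swap (π a) (π a')) x = x := by
    intro x h1 h2 h3 h4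
    rw [Equiv.Perm.mul_apply, Equiv.swap_apply_of_ne_of_ne h3 h4, Equiv.swap_apply_of_ne_of_ne h1 h2]
  -- a uniform case analysis on the image of a vertex
  have key : ∀ (P : Fin n → Prop), (P a ↔ P a') → (P (π a) ↔ P (π a')) →
      ∀ i, P ((Equiv.swap a a' * Equiv.swap (π a) (π a')) i) ↔ P i := by
    intro P h1 h2 i
    by_cases e1 : i = a
    · rw [e1, ga]; exact h1.symm
    by_cases e2 : i = a'
    · rw [e2, gb]; exact h1
    by_cases e3 : i = π a
    · rw [e3, gπa]; exact h2.symm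
    by_cases e4 : i = π a'
    · rw [e4, gπb]; exact h2
    rw [gx i e1 e2 e3 e4]
  refine ⟨?_, key (· ∈ S) (iff_of_true haS ha'S) (iff_of_true (hS a haS) (hS a' ha'S)),
    key (· ∈ H) (iff_of_true haH ha'H) (iff_of_false hπaH hπa'H), ga, gb, gx⟩
  -- commutes with `π`
  intro i
  by_cases h1 : i = a
  · rw [h1, ga, gπa]
  by_cases h2 : i = a'
  · rw [h2, gb, gπb]
  by_cases h3 : i = π a
  · rw [h3, hπ, gπa, ga, hπ]
  by_cases h4 : i = π a'
  · rw [h4, hπ, gπb, gb, hπ]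
  have k1 : π i ≠ a := fun h => h3 (by rw [← h, hπ])
  have k2 : π i ≠ a' := fun h => h4 (by rw [← h, hπ])
  have k3 : π i ≠ π a := fun h => h1 (by rw [← hπ i, h, hπ])
  have k4 : π i ≠ π a' := fun h => h2 (by rw [← hπ i, h, hπ])
  rw [gx i h1 h2 h3 h4, gx _ k1 k2 k3 k4]

/-- `|reps(AA_S(H))| = 0` (the hypothesis of bricks 151a–156) says that no edge of the stable ground set `S` lies inside `H`.
[cite: Rothvoss2017, §2 (PDF p. 5)] -/
theorem no_internal_edge_of_reps_vAA {S : Finset (Fin n)} (hS : ∀ v ∈ S, π v ∈ S) (H : Finset (Fin n))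
    (h0 : (reps π (vAA π S H)).card = 0) : ∀ v ∈ S, ¬ (v ∈ H ∧ π v ∈ H) := by
  intro v hvS hvH
  have h2 := two_mul_card_reps hπ hπ' (vAA_stable hπ S H hS)
  rw [h0, mul_zero] at h2
  have hv : v ∈ vAA π S H := mem_vAA.2 ⟨hvS, hvH.1, hvH.2⟩
  rw [eq_comm, card_eq_zero] at h2
  rw [h2] at hv
  exact notMem_empty v hv

/-- With no edge of `S` inside `H`, the number of edges of `S` meeting `H` is `|reps(BH ∪ BN)| = |S ∩ H|`.
[cite: Rothvoss2017, §2 (PDF p. 5)] -/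
theorem card_reps_vB_eq_card_inter {S : Finset (Fin n)} (hS : ∀ v ∈ S, π v ∈ S) (H : Finset (Fin n))
    (hno : ∀ v ∈ S, ¬ (v ∈ H ∧ π v ∈ H)) : (reps π (vBH π S H ∪ vBN π S H)).card = (S ∩ H).card := by
  have h2 := two_mul_card_reps hπ hπ' (vB_stable hπ S H hS)
  have hAA : vAA π S H = ∅ := by
    rw [eq_empty_iff_forall_notMem]
    intro v hv
    rw [mem_vAA] at hv
    exact hno v hv.1 hv.2
  have h3 := card_vAA_add_card_vBH (π := π) S H
  rw [hAA, card_empty, zero_add] at h3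
  have h4 := card_vBH_eq_card_vBN hπ hS H
  have hdisj : Disjoint (vBH π S H) (vBN π S H) := by
    rw [disjoint_left]
    intro v h1 h2
    exact (mem_vBN.1 h2).2.1 (mem_vBH.1 h1).2.1
  rw [card_union_of_disjoint hdisj] at h2
  omega

end Swap

/-! ### §3 Exchangeability of the in-set fibres -/

section Fibre

variable (hπ : ∀ v, π (π v) = v) (hπ' : ∀ v, π v ≠ v)
include hπ hπ'

/-- **The in-set fibre count is exchangeable.** `S` stable, `H` without an edge of `S` inside: for `I, I′ ⊆ S ∩ H` with `|I| = |I′|`,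
`#{U ∈ Shell_S(t,c) : U ∩ H = I} = #{U ∈ Shell_S(t,c) : U ∩ H = I′}` (induction on `|I ∖ I′|`, one edge swap at a time).
[cite: Rothvoss2017, §2 (PDF p. 6)] [cite: GodsilMeagher2015, §15.2] -/
theorem card_filter_inter_eq_eq_of_card_eq {S H : Finset (Fin n)} (hS : ∀ v ∈ S, π v ∈ S)
    (hno : ∀ v ∈ S, ¬ (v ∈ H ∧ π v ∈ H)) (t c : ℕ) {I I' : Finset (Fin n)} (hI : I ⊆ S ∩ H) (hI' : I' ⊆ S ∩ H)
    (hcard : I.card = I'.card) :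
    ((shellIn π S t c).filter fun U => U ∩ H = I).card = ((shellIn π S t c).filter fun U => U ∩ H = I').card := by
  classical
  -- induction on the distance `|I ∖ I′|`
  suffices h : ∀ k : ℕ, ∀ I : Finset (Fin n), I ⊆ S ∩ H → I.card = I'.card → (I \ I').card = k →
      ((shellIn π S t c).filter fun U => U ∩ H = I).card = ((shellIn π S t c).filter fun U => U ∩ H = I').card from
    h _ I hI hcard rfl
  intro k
  induction k with
  | zero =>
    intro I hI hcard h0
    rw [card_eq_zero, sdiff_eq_empty_iff_subset] at h0
    rw [eq_of_subset_of_card_le h0 hcard.ge]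
  | succ k ih =>
    intro I hI hcard hk
    -- pick `a ∈ I ∖ I′` and `a′ ∈ I′ ∖ I`
    obtain ⟨a, ha⟩ : (I \ I').Nonempty := by rw [← card_pos, hk]; exact Nat.succ_pos k
    obtain ⟨a', ha'⟩ : (I' \ I).Nonempty := by rw [← card_pos, ← card_sdiff_comm hcard, hk]; exact Nat.succ_pos k
    obtain ⟨haI, haI'⟩ := mem_sdiff.1 ha
    obtain ⟨ha'I', ha'I⟩ := mem_sdiff.1 ha'
    have hne : a' ≠ a := fun h => ha'I (h ▸ haI)
    obtain ⟨g, hgπ, hgS, hgH, hga, -, hgx⟩ := exists_edge_swap hπ hπ' hS hno (hI haI) (hI' ha'I') hne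
    -- the image in-set `g(I) = I − a + a′`
    have hπaH : π a ∉ H := fun h => hno a (mem_inter.1 (hI haI)).1 ⟨(mem_inter.1 (hI haI)).2, h⟩
    have hπa'H : π a' ∉ H := fun h => hno a' (mem_inter.1 (hI' ha'I')).1 ⟨(mem_inter.1 (hI' ha'I')).2, h⟩
    have hfix : ∀ x ∈ I, x ≠ a → g x = x := by
      intro x hx hxa
      have hxH : x ∈ H := (mem_inter.1 (hI hx)).2
      exact hgx x hxa (fun h => ha'I (h ▸ hx)) (fun h => hπaH (h ▸ hxH)) (fun h => hπa'H (h ▸ hxH))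
    have himg : I.map g.toEmbedding = insert a' (I.erase a) := by
      ext x
      rw [mem_map_equiv, mem_insert, mem_erase]
      constructor
      · intro hx
        by_cases hxa : g.symm x = a
        · left; rw [← hga, ← hxa, Equiv.apply_symm_apply]
        · right
          have e : g (g.symm x) = g.symm x := hfix _ hx hxa
          rw [Equiv.apply_symm_apply] at e
          refine ⟨fun h => ?_, e ▸ hx⟩
          rw [← e, h] at hxa; exact hxa rfl
      · rintro (rfl | ⟨hxa, hx⟩)
        · rw [← hga, Equiv.symm_apply_apply]; exact haI
        · have e : g x = x := hfix x hx hxa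
          rw [← e, Equiv.symm_apply_apply]; exact hx
    -- apply the transport and the induction hypothesis to `g(I)`
    rw [← card_filter_inter_eq_map g hgπ hgS hgH t c I, himg]
    refine ih _ ?_ ?_ ?_
    · exact insert_subset (hI' ha'I') ((erase_subset a I).trans hI)
    · rw [card_insert_of_notMem (fun h => ha'I (mem_of_mem_erase h)), card_erase_of_mem haI, ← hcard]
      have := card_pos.2 ⟨a, haI⟩; omega
    · have e : insert a' (I.erase a) \ I' = (I \ I').erase a := by
        ext x
        simp only [mem_sdiff, mem_insert, mem_erase]
        constructor
        · rintro ⟨h1 | ⟨h2, h3⟩, h4⟩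
          · exact absurd ha'I' (h1 ▸ h4)
          · exact ⟨h2, h3, h4⟩
        · rintro ⟨h1, h2, h3⟩; exact ⟨Or.inr ⟨h1, h2⟩, h3⟩
      rw [e, card_erase_of_mem ha, hk, Nat.add_sub_cancel]

end Fibre

end Summit.PneNP.PneNP.Theorems.ChebyshevTracialDesignBlockEdgeSwaps

end
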